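import Summits.ResolutionOfSingularities.ResolutionOfSingularities.Theses.PAlteration
import Summits.ResolutionOfSingularities.ResolutionOfSingularities.Theorems.PAlterationPicoverOfDegP
import Literature.AlgebraicGeometry.Resolution.KummerNormalForm
import Literature.AlgebraicGeometry.Resolution.LogRegularAtlas
import Literature.AlgebraicGeometry.Resolution.LogRegularAtlasGluing
import Literature.AlgebraicGeometry.Resolution.DivisorialMonoid
import Literature.AlgebraicGeometry.Resolution.NormalizationInExtension
import Summits.ResolutionOfSingularities.ResolutionOfSingularities.Theorems.PAlterationPicoverSectionsNormalizationInRoot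
import Summits.ResolutionOfSingularities.ResolutionOfSingularities.Theorems.PAlterationPicoverLocalChartSepWoundCentre
import Summits.ResolutionOfSingularities.ResolutionOfSingularities.Theorems.PAlterationPicoverLocalChartSepKummerCentre

/-!
# Crux `Picover` (stmt-ResolutionOfSingularities-0554) — line `giraud-separated-base`
# (strategist s1, 2026-08-17; ADOPTED and reshaped by the line lead a3, 2026-08-17:
# `stub_endgameAtlasSep` is now the THEOREM `endgameAtlasSep` modulo the pointwise
# `stub_localChartsSep`, exactly as the sibling 0557 line's v4 `endgameAtlas`/`stub_localCharts`)

The crux: for every prime `p`, field `k` of characteristic `p`, regular integral separated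
finite-type `k`-scheme `Y` and finite, universally injective, surjective `g : X → Y` with `X`
integral, `Scheme.HasResolution X`.

Frame shared with the lead (tree, sorry-free): `Picover ⟸ residue`
(`Theorems.Picover.OfDegP.picover_of_picoverDegP`, p91343): it suffices to resolve
`W^L = normalizationIn W L` for `W` regular integral separated of finite type over `k` and
`L/K(W)` purely inseparable of degree `p` (one `p`-th root, `L = K(W)(a^{1/p})`).

Line ("normalise the RADICAND on the REGULAR BASE, never the cover"; Giraud 1983, Cossart 1987,
Cossart–Piltant 2008 Part I, Posva 2024 App. A; the separated-base completion of the line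
`SketchIdeator3` of the sibling crux `PicoverLocalModel`, stmt-0557):
* `stub_giraudNormalFormSep` — THE RESIDUE (research; Giraud's normal-form conjecture for the
  class of `L` on a SEPARATED regular base of dimension `n`; printed `n = 2` (Giraud 1983,
  Thm. 2.4, over perfect `k`), `n = 3` (Cossart 1987 over `k̄`, the key input of
  Cossart–Piltant 2008 Part I), OPEN `n ≥ 4`): some proper birational `ρ : W' → W` with `W'`
  REGULAR and an snc boundary `E` on `W'` such that at every point `w' ∈ W'` some local
  representative `b ∈ 𝒪_{W,ρ w'}` of the class of `L` (`L = K(W)(b^{1/p})`) is, pulled back to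
  `𝒪_{W',w'}`, in the intrinsic boundary-adapted Giraud normal form `GiraudNormalFormAt`
  (`Literature/…/KummerNormalForm.lean`): EITHER `b = g^p + (∏ x_j^{B_j})^p u` with `u`
  wound-or-transversal, OR `b = g^p + u ∏ x_j^{A_j}`, `u` a unit, some `A_j` prime to `p`.
* `stub_endgameAtlasSep` — THE ENDGAME, ALGEBRAIC HALF (printed algebra, Lean-heavy; the
  separated twin of 0557's `stub_endgameAtlas` / `stub_localCharts`, same local charts): under
  the normal form, `W'^L = normalizationIn W' L` (for the `K(W')`-algebra structure of `L`
  induced by the birational `ρ`) has a proper birational model carrying a log-regular Zariski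
  fs atlas (`LogRegularAtlas`): regular with snc boundary over wound/transversal points
  (`t'^p = u`, `t' = (t - g)/x^B`), toric `w^p = x'_{j₀} ∏_{j ≠ j₀} x_j^{c_j}` over Kummer points
  (Kummer twist `w = t^α x_{j₀}^β`, `α A_{j₀} + β p = 1`), all charts generating the divisorial
  log structure of `ρ'^{-1} E`.
* `stub_logResolution` — THE ENDGAME, RESOLUTION HALF = the NAMED FACT Kato 1994 (10.4) /
  Nizioł 2006 Thm. 5.8 (`Kato1994_logRegular_hasResolution_general`), verbatim the stub of the
  0557 line (one literature debt serves both cruxes).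
Composition (`picoverDegP_of_stubs`, `Picover_of`, kernel-checked): residue on `W'`; `L` becomes a
`K(W')`-algebra through `K(W) ≅ K(W')` (`ρ` birational); endgame atlas + Kato resolve `W'^L`;
the comparison `W'^L → W^L` is proper birational (tree:
`TowerTransport.hasResolution_normalizationIn_of_isProper`, generic fibre of `ρ` = generic
point); `OfDegP.picover_of_picoverDegP` closes `Picover` BY NAME.

Why this line next to the lead's `degree-p-tower` (whose only research stub is the KERNEL
`stub_picoverKernel`, Temkin's local hypothesis in blow-up form at points of local dimension
`≥ 4`): the kernel quantifies over ALL blow-ups `S'` of the germ `Spec 𝒪_{W^L,x}` that are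
regular off the closed fibre; the normalisation of such an `S'` is `Nor_L` of a NORMAL, in
general SINGULAR, blow-up of the regular germ `Spec 𝒪_{W,w}` (`NBl_I X = Nor_L (NBl_{I^{[p]}} W)`),
so any base-driven attack on the kernel must first re-regularise a blown-up regular 4-fold germ
(principalisation on regular 4-folds, itself open) AND respect "isomorphism over `Reg S'`" at
points where `S'` is regular but its Frobenius base is not. This line never leaves the class
{regular base, one `p`-th root}: every modification is a blow-up of the REGULAR base in a regular
centre, the cover is only ever normalised, and gluing costs nothing because `W'` is global. Its
research stub is a statement about ONE class `[L] ∈ K(W)^× / K(W)^{×p}` on a regular variety that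
stays regular — the format of Giraud/Cossart/CJS invariant technology, one ambient dimension
below the embedded hypersurface `T^p - a ⊂ W × 𝔸¹` — and it is SHARED in substance with the live
0557 line (affine base), so progress on either crux serves both.

RESHAPE (lead a3, 2026-08-17). `stub_endgameAtlasSep` asked for SOME proper birational
`ν : Y' → W'^L` with a `LogRegularAtlas` on `Y'`; on paper `ν = 𝟙` (`W'^L` is normal, hence IS
the log-regular model). The registered stubs are now
* `stub_giraudNormalFormSep` (RESEARCH, the lead's; unchanged);
* `stub_localChartsSep` (PRINTED ALGEBRA, Lean-heavy; the separated twin of 0557's pointwise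
  `stub_localCharts`): every point `y` of `W'^L` has an affine neighbourhood with ONE fs chart,
  log regular at every prime, whose stalk monoids are the divisorial monoids of the pulled-back
  boundary (`divisorialMonoid` of the extension to `𝒪_{W'^L,y}` of the product of the stalk
  ideals of the members of `E` at the image point `w'`) — the stalk of `W'^L` at `y` is the
  integral closure of `𝒪_{W',w'}` in `L` (`Theorems.Picover.StalkNormalizationIn`, p137224), a
  wound twist `𝒪[t']/(t'^p - u)` (regular, `x_j` still parameters:
  `Theorems.PicoverLocalModel.WoundTwistParameters`) over a wound/transversal point and the toric
  root cover (`Theorems.PicoverLocalModel.KummerToricClosure`) over a Kummer point;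
* `stub_logResolution` (NAMED FACT Kato 1994 (10.4); unchanged);
and `endgameAtlasSep` is a THEOREM: `Y' := W'^L`, `ν := 𝟙` (proper, birational), the atlas
glued from the local charts by `logRegularAtlas_of_localLogRegularChart` (Kato (1.5)(S),
p136149) on the quasi-compact (`W` quasi-compact over `k`, `ρ` proper, `W'^L → W'` finite)
locally Noetherian scheme `W'^L`. The theorem carries `[QuasiCompact f]` (available in the
composition), which the old stub did not need to mention.
-/

noncomputable section

set_option linter.dupNamespace false

open CategoryTheory CategoryTheory.Limits AlgebraicGeometry TopologicalSpace Polynomial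
open Literature.AlgebraicGeometry.Resolution Literature.AlgebraicGeometry.Motives
open Summit.ResolutionOfSingularities.ResolutionOfSingularities.Theorems.Picover

namespace Summit.ResolutionOfSingularities.ResolutionOfSingularities.Cruxes.Picover.GiraudSeparatedBase

/-! ## Stubs -/

/-- STUB — THE RESIDUE (research content; Giraud's normal-form conjecture, Giraud 1983 p. 115,
for the class of a height-one purely inseparable extension on a SEPARATED regular base; printed
for `dim W = 2` over perfect fields (Giraud 1983, Thm. 2.4) and `dim W = 3` over algebraically
closed fields (Cossart 1987, see Posva 2024 App. A; Cossart–Piltant 2008 Part I); OPEN for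
`dim W ≥ 4` = `Literature.Barriers.ResolutionOfSingularities.DimensionFourFrontier`; `dim W ≤ 1`
provable from the DVR dichotomy `Theorems/PAlterationPicoverLocalModelDvrDichotomy.lean`).
**Giraud normal form of a `p`-th-root class on a separated regular base** (UNIFORM-SECTIONS
format, lead a3 reshape 2026-08-17 — the format Giraud's theory produces and the endgame
consumes, identical in shape to `InGiraudNormalForm` of crux 0557). For `k` a field of
characteristic `p`, `W` a regular integral separated `k`-scheme of finite type and `L/K(W)`
purely inseparable of degree `p`: there are a proper birational (dominant) `ρ : W' → W` with
`W'` integral and REGULAR and a simple-normal-crossings boundary `E` on `W'` (`HasSNC`) such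
that every point `w' ∈ W'` has an affine neighbourhood `U` carrying a SECTION `a ∈ Γ(W', U)`
which represents the class of `L` (some `y ∈ L ∖ K(W)` has `y^p = c` with `ρ^♯ c` = the image of
`a` in `K(W')`, `ρ^♯ : K(W) ≅ K(W')` the birational identification) and whose germ at EVERY
point `w'' ∈ U` is in Giraud normal form (`GiraudNormalFormAt`, for some enumeration `D` of the
boundary components through `w''` with local equations `x_j`: `a = g^p + (∏ x_j^{B_j})^p · u`
with `u` wound-or-transversal, or `a = g^p + u · ∏ x_j^{A_j}` with `u` a unit and some
`p ∤ A_j`; the `p`-th power `g^p` absorbs the point-dependent correction of the representative).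
On paper (dim `≤ 3`): blow up regular global centres inside the closed set where the saturated
Pfaff line `(𝒪_{W_i} · da)^{sat} ⊆ Ω¹_{W_i}(log E_i)` is not a direct summand (Giraud's
`V(J(W_i,a,E_i))`, class-invariant and OPEN), keeping the exceptional components in the boundary;
Giraud's Prop. 1.5 turns `J = 𝒪` at a point into the normal form of the FIXED `a` there. The
dim `≤ 1` calibration of the earlier pointwise-germ format is landed
(`Theorems.Picover.NormalFormSepDimLeOne`, p145812, empty boundary). [cite: Giraud1983, Thm. 2.4, Prop. 1.5 and p. 115] -/
theorem stub_giraudNormalFormSep : ∀ (p : ℕ), p.Prime → ∀ (k : Type) [Field k] [CharP k p]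
    (W : Scheme.{0}) [IsIntegral W] (f : W ⟶ Spec (.of k)) (L : Type) [Field L]
    [Algebra W.functionField L], IsSeparated f → LocallyOfFiniteType f → QuasiCompact f →
    Scheme.IsRegular W → IsPurelyInseparable W.functionField L →
    Module.finrank W.functionField L = p →
    ∃ (W' : Scheme.{0}) (_ : IsIntegral W') (ρ : W' ⟶ W) (_ : IsDominant ρ)
      (E : List W'.IdealSheafData),
      IsProper ρ ∧ IsBirational ρ ∧ Scheme.IsRegular W' ∧ HasSNC E ∧
      ∀ w' : W', ∃ (U : W'.affineOpens) (hU : w' ∈ (U : W'.Opens)) (a : Γ(W', (U : W'.Opens))),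
        (∃ (y : L) (c : W.functionField), y ∉ (algebraMap W.functionField L).range ∧
          y ^ p = algebraMap W.functionField L c ∧
          RatFn.functionFieldMap ρ c =
            algebraMap (W'.presheaf.stalk w') W'.functionField
              (W'.presheaf.germ (U : W'.Opens) w' hU a)) ∧
        ∀ (w'' : W') (hw'' : w'' ∈ (U : W'.Opens)), ∃ (r : ℕ)
          (D : Fin r → {D : W'.IdealSheafData // D ∈ E ∧ w'' ∈ D.support})
          (x : Fin r → W'.presheaf.stalk w''), Function.Bijective D ∧
          (∀ j, stalkIdeal (D j).1 w'' = Ideal.span {x j}) ∧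
          GiraudNormalFormAt p x (W'.presheaf.germ (U : W'.Opens) w'' hw'' a) := by
  sorry

/-- STUB — THE ENDGAME, ALGEBRAIC HALF, LOCAL FORM (printed algebra, Lean-heavy; the separated
twin of the 0557 line's pointwise `stub_localCharts` — Giraud 1983 Prop. 1.5, Kato 1994
Thm. 11.6 / (3.1); tree inputs: `Theorems.Picover.StalkNormalizationIn` (stalk of `W'^L` at `y`
= integral closure of `𝒪_{W',w'}` in `L`, p137224), `Theorems.PicoverLocalModel.KummerTwist`,
`….WoundTwistParameters`, `….WoundTwistIntegralClosure`, `….KummerToricClosure`,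
`….BoundaryTypes`, `Literature.….LogRegularAtlasGluing`, `Literature.….DivisorialMonoid`).
**Local log-regular charts on the normalised cover of a `p`-th-root class in Giraud normal
form.** Data: `W` integral, locally of finite type over `k`, `L/K(W)` purely inseparable of degree
`p`; `ρ : W' → W` proper birational with `W'` integral regular, `E` an snc boundary on `W'`, `L`
regarded as a `K(W')`-algebra compatibly with `ρ^♯ : K(W) → K(W')`; the class of `L` in Giraud
normal form along `E` locally uniformly on `W'` (sections `a` on affine opens with normal form at
every point of the open, as in `stub_giraudNormalFormSep`). It is assembled (lead a3, after the
0557 chain landed its `stub_localCharts`) from the registered helper stubs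
`sections_normalizationIn_of_root` (cover-side package: `Γ(W'^L, ι⁻¹V) =` integral closure of
`Γ(W', V)` in `L`, generated by the `p`-th root up to denominators),
`localChartSep_woundCentre` / `localChartSep_kummerCentre` (the 0557 assemblies
`localChart_woundCentre` / `localChart_kummerCentre` for an ABSTRACT cover `Z → W'` with that
package) and `pointData_giraudNormalFormAt_of_pointwise` (p147267). Conclusion: every
point `y` of `W'^L = normalizationIn W' L` has an affine neighbourhood with ONE fs chart, log
regular at every prime, whose stalk monoids are the boundary log structure of `ι⁻¹ E`
(`ι : W'^L → W'`): the `divisorialMonoid` of the extension to `𝒪_{W'^L,y}` of the product of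
the stalk ideals at `ι y` of the members of `E` (the germs invertible off the preimage of
`⋃ E`). Over a wound/transversal point `w'` the stalk of `W'^L` is the wound twist
`𝒪_{W',w'}[t']/(t'^p - u)` (regular, the `x_j` still parameters; chart `ℕ^r → (x_j)`); over a
Kummer point, after the twist `w = t^α x_{j₀}^β` (`α A_{j₀} + β p = 1`), it is the toric
`⊕_{i<p} 𝒪_{W',w'}·w^i/x^{⌊iA'/p⌋}` with chart the saturation of `⟨e_1, …, e_r, (Σ A'_j e_j)/p⟩`,
log regular at every prime (Kato (2.1)); all charts generate the divisorial log structure of the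
reduced preimage of `E`, so neighbouring charts are compatible by construction.
[cite: Giraud1983, Prop. 1.5] [cite: Kato1994, Thm. 11.6] -/
theorem localChartsSep : ∀ (p : ℕ) [Fact p.Prime] (k : Type) [Field k] [CharP k p]
    (W : Scheme.{0}) [IsIntegral W] (f : W ⟶ Spec (.of k)) [LocallyOfFiniteType f]
    (L : Type) [Field L] [Algebra W.functionField L] [FiniteDimensional W.functionField L]
    (W' : Scheme.{0}) [IsIntegral W'] (ρ : W' ⟶ W) [IsProper ρ] [IsDominant ρ]
    (E : List W'.IdealSheafData) [Algebra W'.functionField L],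
    (algebraMap W'.functionField L).comp (RatFn.functionFieldMap ρ) =
      algebraMap W.functionField L →
    IsBirational ρ → Scheme.IsRegular W' → HasSNC E →
    IsPurelyInseparable W.functionField L → Module.finrank W.functionField L = p →
    (∀ w' : W', ∃ (U : W'.affineOpens) (hU : w' ∈ (U : W'.Opens)) (a : Γ(W', (U : W'.Opens))),
        (∃ (y : L) (c : W.functionField), y ∉ (algebraMap W.functionField L).range ∧
          y ^ p = algebraMap W.functionField L c ∧
          RatFn.functionFieldMap ρ c =
            algebraMap (W'.presheaf.stalk w') W'.functionField
              (W'.presheaf.germ (U : W'.Opens) w' hU a)) ∧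
        ∀ (w'' : W') (hw'' : w'' ∈ (U : W'.Opens)), ∃ (r : ℕ)
          (D : Fin r → {D : W'.IdealSheafData // D ∈ E ∧ w'' ∈ D.support})
          (x : Fin r → W'.presheaf.stalk w''), Function.Bijective D ∧
          (∀ j, stalkIdeal (D j).1 w'' = Ideal.span {x j}) ∧
          GiraudNormalFormAt p x (W'.presheaf.germ (U : W'.Opens) w'' hw'' a)) →
    ∀ y : ↥(normalizationIn W' L),
      Nonempty (LocalLogRegularChart (normalizationIn W' L)
        (fun y => divisorialMonoid (((E.map fun D => stalkIdeal D ((normalizationInι W' L).base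
          y))).prod.map ((normalizationInι W' L).stalkMap y).hom)) y) := by
  intro p _ k _ _ W _ f _ L _ _ _ W' _ ρ _ _ E _ hcompat hbir hW'reg hE hPI hdeg hNF y
  classical
  have hp : p.Prime := Fact.out
  set ι := normalizationInι W' L with hι
  -- `L` over `K(W')`: same range, purely inseparable, degree `p`
  have hbij : Function.Bijective (RatFn.functionFieldMap ρ) :=
    TowerTransport.bijective_functionFieldMap_of_isIso ρ hbir.isIso_stalkMap_genericPoint
  let e : W.functionField ≃+* W'.functionField := RingEquiv.ofBijective _ hbij
  have halg : algebraMap W'.functionField L =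
      (algebraMap W.functionField L).comp e.symm.toRingHom := by
    refine RingHom.ext fun x => ?_
    rw [RingHom.comp_apply, ← hcompat, RingHom.comp_apply]
    exact congrArg (algebraMap W'.functionField L) (e.apply_symm_apply x).symm
  have hrange : (algebraMap W'.functionField L).range = (algebraMap W.functionField L).range := by
    ext z
    simp only [RingHom.mem_range]
    constructor
    · rintro ⟨x, rfl⟩
      exact ⟨e.symm x, by rw [halg]; rfl⟩
    · rintro ⟨x, rfl⟩
      exact ⟨e x, by rw [← hcompat]; rfl⟩
  have hdeg' : Module.finrank W'.functionField L = p := by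
    rw [← hdeg]
    exact Algebra.finrank_eq_of_equiv_equiv e.symm (RingEquiv.refl L) (by ext x; simp [halg])
  haveI : CharP W.functionField p := by
    haveI : Nonempty (⊤ : W.Opens) := ⟨⟨genericPoint W, trivial⟩⟩
    let φ : k →+* W.functionField :=
      (W.germToFunctionField ⊤).hom.comp ((f.appTop).hom.comp (Scheme.ΓSpecIso (.of k)).inv.hom)
    exact (φ.charP_iff_charP p).mp inferInstance
  haveI : ExpChar W.functionField p := ExpChar.prime hp
  haveI : CharP W'.functionField p := (e.toRingHom.charP_iff_charP p).mp inferInstance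
  haveI : ExpChar W'.functionField p := ExpChar.prime hp
  haveI : IsPurelyInseparable W'.functionField L := by
    rw [isPurelyInseparable_iff_pow_mem W'.functionField p]
    intro z
    obtain ⟨n, hn⟩ := (isPurelyInseparable_iff_pow_mem W.functionField p).mp hPI z
    exact ⟨n, hrange ▸ hn⟩
  -- the uniform normal form around the image point
  obtain ⟨U, hU, a, ⟨yL, c, hyK, hyp, hc⟩, hGU⟩ := hNF (ι.base y)
  haveI : Nonempty (U : W'.Opens) := ⟨⟨_, hU⟩⟩
  have hyK' : yL ∉ (algebraMap W'.functionField L).range := hrange ▸ hyK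
  have hyp' : yL ^ p = algebraMap W'.functionField L (W'.germToFunctionField (U : W'.Opens) a) := by
    rw [hyp, ← hcompat, RingHom.comp_apply, hc, Scheme.algebraMap_germ_eq_germToFunctionField]
  -- the cover-side package over every affine `V ≤ U`
  have hsecZ : ∀ (V : W'.affineOpens) (hV : (V : W'.Opens) ≤ U),
      Nonempty (ι ⁻¹ᵁ (V : W'.Opens)) → IsAffineOpen (ι ⁻¹ᵁ (V : W'.Opens)) ∧
      IsIntegrallyClosed Γ(normalizationIn W' L, ι ⁻¹ᵁ (V : W'.Opens)) ∧
      (ι.app (V : W'.Opens)).hom.IsIntegral ∧ Function.Injective (ι.app (V : W'.Opens)) ∧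
      ∃ t : Γ(normalizationIn W' L, ι ⁻¹ᵁ (V : W'.Opens)),
        t ^ p = ι.app (V : W'.Opens) (W'.presheaf.map (homOfLE hV).op a) ∧
        ∀ z : Γ(normalizationIn W' L, ι ⁻¹ᵁ (V : W'.Opens)), ∃ d : Γ(W', (V : W'.Opens)),
          d ≠ 0 ∧ ∃ P : Γ(W', (V : W'.Opens))[X],
            ι.app (V : W'.Opens) d * z = P.eval₂ (ι.app (V : W'.Opens)).hom t := by
    intro V hV hne
    obtain ⟨⟨z, hz⟩⟩ := hne
    haveI : Nonempty (V : W'.Opens) := ⟨⟨ι.base z, hz⟩⟩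
    have hypV : yL ^ p = algebraMap W'.functionField L
        (W'.germToFunctionField (V : W'.Opens) (W'.presheaf.map (homOfLE hV).op a)) := by
      rw [hyp', ← Scheme.algebraMap_germ_eq_germToFunctionField W' (hV hz),
        ← Scheme.algebraMap_germ_eq_germToFunctionField W' hz, germ_map_homOfLE]
    exact SectionsNormalizationInRoot.sections_normalizationIn_of_root p W' L hdeg' V _ yL hyK' hypV
  -- dispatch on the alternative of the normal form at the centre
  haveI : LocallyOfFiniteType (ρ ≫ f) := inferInstance
  obtain ⟨r, D, x, hDbij, hDgen, hNFc⟩ := hGU (ι.base y) hU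
  rcases hNFc with ⟨g₀, u₀, Bexp, hwt, ha⟩ | ⟨g₀, Aexp, v₀, ⟨j₀, hj₀⟩, ha⟩
  · exact LocalChartSepWoundCentre.localChartSep_woundCentre p k W' (ρ ≫ f) hW'reg E hE U a hGU
      (normalizationIn W' L) ι hsecZ y _ rfl hU D x hDbij hDgen g₀ u₀ Bexp hwt ha
  · exact LocalChartSepKummerCentre.localChartSep_kummerCentre p k W' (ρ ≫ f) hW'reg E hE U a hGU
      (normalizationIn W' L) ι hsecZ y _ rfl hU D x hDbij hDgen g₀ Aexp v₀ j₀ hj₀ ha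

/-- **The endgame atlas** (the strategist's `stub_endgameAtlasSep`, now a THEOREM modulo the
pointwise `stub_localChartsSep`; separated twin of the 0557 line's v4 `endgameAtlas`). Under the
endgame hypotheses and with `W` quasi-compact over `k`, the normalised cover
`W'^L = normalizationIn W' L` ITSELF is the log-regular model: `Y' := W'^L`, `ν := 𝟙` (proper,
birational), and `W'^L` — quasi-compact (`W` quasi-compact, `ρ` proper, `W'^L → W'` finite by
E. Noether / Liu 4.1.27, `isFinite_normalizationInι`) and locally Noetherian (locally of finite
type over `k`) — carries the log-regular Zariski fs atlas glued from the local charts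
(`logRegularAtlas_of_localLogRegularChart`, Kato (1.5)(S)). [folklore] -/
theorem endgameAtlasSep (p : ℕ) [Fact p.Prime] (k : Type) [Field k] [CharP k p]
    (W : Scheme.{0}) [IsIntegral W] (f : W ⟶ Spec (.of k)) [LocallyOfFiniteType f]
    [QuasiCompact f]
    (L : Type) [Field L] [Algebra W.functionField L] [FiniteDimensional W.functionField L]
    (W' : Scheme.{0}) [IsIntegral W'] (ρ : W' ⟶ W) [IsProper ρ] [IsDominant ρ]
    (E : List W'.IdealSheafData) [Algebra W'.functionField L]
    (hcompat : (algebraMap W'.functionField L).comp (RatFn.functionFieldMap ρ) =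
      algebraMap W.functionField L)
    (hbir : IsBirational ρ) (hW'reg : Scheme.IsRegular W') (hE : HasSNC E)
    (hPI : IsPurelyInseparable W.functionField L) (hdeg : Module.finrank W.functionField L = p)
    (hNF : ∀ w' : W', ∃ (U : W'.affineOpens) (hU : w' ∈ (U : W'.Opens)) (a : Γ(W', (U : W'.Opens))),
        (∃ (y : L) (c : W.functionField), y ∉ (algebraMap W.functionField L).range ∧
          y ^ p = algebraMap W.functionField L c ∧
          RatFn.functionFieldMap ρ c =
            algebraMap (W'.presheaf.stalk w') W'.functionField
              (W'.presheaf.germ (U : W'.Opens) w' hU a)) ∧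
        ∀ (w'' : W') (hw'' : w'' ∈ (U : W'.Opens)), ∃ (r : ℕ)
          (D : Fin r → {D : W'.IdealSheafData // D ∈ E ∧ w'' ∈ D.support})
          (x : Fin r → W'.presheaf.stalk w''), Function.Bijective D ∧
          (∀ j, stalkIdeal (D j).1 w'' = Ideal.span {x j}) ∧
          GiraudNormalFormAt p x (W'.presheaf.germ (U : W'.Opens) w'' hw'' a)) :
    ∃ (Y' : Scheme.{0}) (ν : Y' ⟶ normalizationIn W' L),
      IsProper ν ∧ IsBirational ν ∧ Nonempty (LogRegularAtlas Y') := by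
  -- `L` is finite over `K(W')` too (same degree, `ρ` birational)
  have hp : p.Prime := Fact.out
  have hbij : Function.Bijective (RatFn.functionFieldMap ρ) :=
    TowerTransport.bijective_functionFieldMap_of_isIso ρ hbir.isIso_stalkMap_genericPoint
  let e : W.functionField ≃+* W'.functionField := RingEquiv.ofBijective _ hbij
  have halg : algebraMap W'.functionField L =
      (algebraMap W.functionField L).comp e.symm.toRingHom := by
    refine RingHom.ext fun x => ?_
    rw [RingHom.comp_apply, ← hcompat, RingHom.comp_apply]
    exact congrArg (algebraMap W'.functionField L) (e.apply_symm_apply x).symm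
  have hdeg' : Module.finrank W'.functionField L = p := by
    rw [← hdeg]
    exact Algebra.finrank_eq_of_equiv_equiv e.symm (RingEquiv.refl L) (by ext x; simp [halg])
  haveI : FiniteDimensional W'.functionField L :=
    Module.finite_of_finrank_pos (by rw [hdeg']; exact hp.pos)
  -- `W'` is locally of finite type and quasi-compact over `k`, hence so is `W'^L`
  haveI : LocallyOfFiniteType (ρ ≫ f) := inferInstance
  haveI : IsFinite (normalizationInι W' L) := isFinite_normalizationInι W' L (ρ ≫ f)
  haveI : CompactSpace ↥W := QuasiCompact.compactSpace_of_compactSpace f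
  haveI : CompactSpace ↥W' := QuasiCompact.compactSpace_of_compactSpace ρ
  haveI : CompactSpace ↥(normalizationIn W' L) :=
    QuasiCompact.compactSpace_of_compactSpace (normalizationInι W' L)
  haveI : IsLocallyNoetherian (normalizationIn W' L) :=
    LocallyOfFiniteType.isLocallyNoetherian (normalizationInι W' L ≫ ρ ≫ f)
  -- the identity is the model; glue the local charts
  have hbir1 : IsBirational (𝟙 (normalizationIn W' L)) :=
    ⟨⊤, by simp [dense_univ], by simp [dense_univ], inferInstance⟩
  refine ⟨normalizationIn W' L, 𝟙 _, inferInstance, hbir1, ?_⟩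
  exact logRegularAtlas_of_localLogRegularChart _ _
    (localChartsSep p k W f L W' ρ E hcompat hbir hW'reg hE hPI hdeg hNF)

/-- STUB — THE ENDGAME, RESOLUTION HALF = the NAMED FACT **Kato 1994, (10.4) (general,
multi-chart form; Nizioł 2006 Thm. 5.8)**: a scheme carrying a log-regular Zariski fs atlas has a
resolution of singularities. Printed theorem, unproved in tree
(`Literature.AlgebraicGeometry.Resolution.Kato1994_logRegular_hasResolution_general`); verbatim
the stub `stub_logResolution` of the 0557 line `SketchIdeator3` — ONE literature debt for both
cruxes; until discharged the line closes the crux CONDITIONALLY on it. [cite: Kato1994, (10.4)] -/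
theorem stub_logResolution : Kato1994_logRegular_hasResolution_general.{0} := by
  sorry

/-! ## Composition -/

/-- **The residue `PicoverDegP` from the three stubs** (statement verbatim = hypothesis of
`OfDegP.picover_of_picoverDegP` = the lead's `stub_picoverDegP`). Giraud normal form on a
regular modification `ρ : W' → W` (`stub_giraudNormalFormSep`); `L` is a `K(W')`-algebra through
the birational identification `K(W) ≅ K(W')`; the endgame atlas and Kato's theorem resolve
`W'^L`; the comparison `W'^L → W^L` is proper birational
(`TowerTransport.hasResolution_normalizationIn_of_isProper`: the fibre of `ρ` over the generic
point is the generic point because `ρ` is an isomorphism over a dense open). [folklore] -/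
theorem picoverDegP_of_stubs : ∀ (p : ℕ), p.Prime → ∀ (k : Type) [Field k] [CharP k p]
    (W : Scheme.{0}) [IsIntegral W] (f : W ⟶ Spec (.of k)) (L : Type) [Field L]
    [Algebra W.functionField L], IsSeparated f → LocallyOfFiniteType f → QuasiCompact f →
    Scheme.IsRegular W → IsPurelyInseparable W.functionField L →
    Module.finrank W.functionField L = p → Scheme.HasResolution (normalizationIn W L) := by
  intro p hp k _ _ W _ f L _ _ hsep hlft hqc hWreg hPI hdeg
  haveI : Fact p.Prime := ⟨hp⟩
  haveI : LocallyOfFiniteType f := hlft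
  haveI : QuasiCompact f := hqc
  haveI : FiniteDimensional W.functionField L :=
    Module.finite_of_finrank_pos (by rw [hdeg]; exact hp.pos)
  -- THE RESIDUE: Giraud normal form of the class of `L` on a regular modification `W'` of `W`
  obtain ⟨W', hW'int, ρ, hdom, E, hρ, hbir, hW'reg, hE, hNF⟩ :=
    stub_giraudNormalFormSep p hp k W f L hsep hlft hqc hWreg hPI hdeg
  haveI := hρ
  -- `L` as a `K(W')`-algebra through the birational identification `ρ^♯ : K(W) ≅ K(W')`
  have hbij : Function.Bijective (RatFn.functionFieldMap ρ) :=
    TowerTransport.bijective_functionFieldMap_of_isIso ρ hbir.isIso_stalkMap_genericPoint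
  let e : W.functionField ≃+* W'.functionField := RingEquiv.ofBijective _ hbij
  letI : Algebra W'.functionField L :=
    ((algebraMap W.functionField L).comp e.symm.toRingHom).toAlgebra
  have halg : algebraMap W'.functionField L =
      (algebraMap W.functionField L).comp e.symm.toRingHom := rfl
  have hcompat : (algebraMap W'.functionField L).comp (RatFn.functionFieldMap ρ) =
      algebraMap W.functionField L := by
    refine RingHom.ext fun x => ?_
    rw [halg, RingHom.comp_apply, RingHom.comp_apply]
    exact congrArg (algebraMap W.functionField L) (e.symm_apply_apply x)
  -- THE ENDGAME, algebraic half: a log-regular atlas on a proper birational model of `W'^L`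
  obtain ⟨Y', ν, hν, hνbir, ⟨atlas⟩⟩ :=
    endgameAtlasSep p k W f L W' ρ E hcompat hbir hW'reg hE hPI hdeg hNF
  haveI := hν
  -- THE ENDGAME, resolution half: Kato 1994 (10.4), then down the proper birational `ν`
  have hres' : Scheme.HasResolution (normalizationIn W' L) :=
    Scheme.HasResolution.of_isBirational ν hνbir (stub_logResolution Y' ⟨atlas⟩)
  -- finiteness of `L` over `K(W')` (same degree `p`)
  have hdeg' : Module.finrank W'.functionField L = p := by
    rw [← hdeg]
    exact Algebra.finrank_eq_of_equiv_equiv e.symm (RingEquiv.refl L) (by ext x; simp [halg])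
  haveI : FiniteDimensional W'.functionField L :=
    Module.finite_of_finrank_pos (by rw [hdeg']; exact hp.pos)
  -- the fibre of `ρ` over the generic point of `W` is the generic point of `W'`
  have hfib : ∀ w' : W', ρ w' = genericPoint W → w' = genericPoint W' := by
    intro w' hw'
    obtain ⟨U, hU, -, hUiso⟩ := hbir
    haveI := hUiso
    have hηU : genericPoint W ∈ U :=
      ((genericPoint_spec W).mem_open_set_iff U.isOpen).mpr (by simpa using hU.nonempty)
    exact TowerTransport.subsingleton_preimage_of_isIso_morphismRestrict ρ U hηU hw'
      (RatFn.genericPoint_eq_of_isDominant ρ)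
  -- TRANSPORT down the proper birational comparison `W'^L → W^L` (tree)
  exact TowerTransport.hasResolution_normalizationIn_of_isProper
    FunctionFieldNormalizationIn.stub_functionField_normalizationIn W f L W' ρ hcompat hfib hres'

/-- **The line closes the crux modulo its stubs**: `Picover` BY NAME, through the landed frame
`OfDegP.picover_of_picoverDegP` (crux ⟸ degree-`p` residue). One stub (`stub_logResolution`) is
the named fact Kato 1994 (10.4), unproved in tree; one (`stub_localChartsSep`) is printed
algebra; one (`stub_giraudNormalFormSep`) is research, open from `dim W = 4`. [folklore] -/
theorem Picover_of :
    Summit.ResolutionOfSingularities.ResolutionOfSingularities.Theses.PAlteration.Picover :=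
  OfDegP.picover_of_picoverDegP picoverDegP_of_stubs

end Summit.ResolutionOfSingularities.ResolutionOfSingularities.Cruxes.Picover.GiraudSeparatedBase

end
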